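import Summits.ABC.ABC.Theorems.TwistAmplificationMazurKaneLawToolkitDefs

/-!
# Crux `TwistAmplification.MazurKaneLaw` (stmt-ABC-2757), line `fibre-toolkit-lp-wall-map`, skeleton v3:
# the SQUARE-ROOT LATTICE TOOL and the enlarged tame region

Route-posited objects of skeleton v3 of the line `fibre-toolkit-lp-wall-map` (lead
prover-line-stmt-ABC-2757-c1-0; tree `Summits/ABC/ABC/Cruxes/MazurKaneLaw/Lines/fibre-toolkit-lp-wall-map.lean`),
typed once here so that the stub files can import them. They extend the vocabulary of
`TwistAmplificationMazurKaneLawToolkitDefs` (`Certified`, `Tame`, `Wild`, `BoxLawOn`, `DetTool`, …) by ONE fibre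
tool that the BBLT linear programme and the v1/v2 kit lack:

* **the square-root lattice tool** `Q(t; H; k)` (multiplicative forms `SqrtLatticeToolX` — host the `x`-term —
  and `SqrtLatticeToolZ` — host the `z`-term; the `y`-host case is the `x`-host case after the swap
  `(c₁, X) ↔ (c₂, Y)`). Freeze every variable except the coordinates `H` of the host term and the level-`k`
  variables `y = yᵢ`, `z = zᵢ` (`k = i + 1 ≥ 2`) of the two other terms. In a counted (coprime!) solution
  `F · m + B yᵏ = C zᵏ` (`F = c₁ · ∏_{j ∉ H} xⱼ^{j+1}` the frozen host cofactor, `m` the host monomial on `H`)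
  the units `y, z, B, C` modulo `F` give `(z/y)ᵏ ≡ B/C (mod F)`, so `z ≡ λ y (mod F)` for one of
  `≤ #μₖ(ℤ/F) ≤ Dτ^{k+1}` root classes `λ` (`natCard_rootsOfUnity_le_pow`), and `gcd(y, z) = 1`; the PRIMITIVE
  points of the congruence lattice `{z ≡ λ y (mod F)}` in the box `|y| ≤ 2Yᵢ, |z| ≤ 2Zᵢ` number
  `≤ 2 + 112 YᵢZᵢ/F` (`card_box_filter_coprime_congr_le` — no successive-minimum term, because the points are
  primitive), and `(y, z)` determines `m`, hence the host coordinates on `H` up to `τ(m)^{d} ≤ Dτ^{d}`. Hence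
  `B_d ≤ #fibres · Dτ^{d+k+1} · (2 + 112 YᵢZᵢ/(c₁ offVal_H X))`. Exponent form (`SqrtLatticeCertifies`):
  `D ≤ max(L − W_t + Σ_{j∈H} j·m_{t,j}, L − Σ_{j∈H} m_{t,j} − m_{t′,k} − m_{t″,k})`, `W_t = log_Λ(c_t · shapeVal)`.
  It contains the ROOT TOOL of `Cruxes/MazurKaneLaw/RootTool.lean` (drefute g2; = the case of a trivial second
  freed variable), certifies the asymmetric walls at the law and — unlike every tool of the v2 kit — the
  "spread" family that holds the kit's plateau at value `1` on `[7/4, 2)` (e.g. `s = 1.85`: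
  `a = u w³ (.4,.2)`, `b = u′x² (.2,.4)`, `c = u″y² (.2,.4)`: host `a`, `H = {0}`, `k = 2` gives `.8 < s − 1`).
* the enlarged certificate / regions `CertifiedPlus = Certified ∨ SqrtLatticeCertifies`, `TameAt θ`
  (certified at `θ + τ`; `TamePlus = TameAt (s − 1)`), `WildPlus = ¬ TamePlus ⊆ Wild`;
* the box law at a general exponent `BoxLawAt R s θ` (`BoxLawOn R s` is the case `θ = s − 1`, by `Iff.rfl`),
  so that the same stub serves the crux (`θ = s − 1`) and certified RECORD exponents `θ = V(s)`;
* the v3 stub statements `ToolkitCertifiedLaw` (provable now), `WallResidualPlus`, `DeepResidualPlus` (open: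
  pieces of the conjecture on the explicit complement `WildPlus`).

Nothing is proved here except one-line sanity lemmas. References: C. Bernert, T. Browning, J. D. Lichtman,
J. Teräväinen, arXiv:2410.12234v2 §§2–6; D. R. Heath-Brown, Math. Z. 187 (1984) (primitive lattice points in a
box); D. Kane, arXiv:1104.2635 (Conj. 1 = the crux).
-/

noncomputable section

-- `Summit.<Summit>.<Problem>` is the mandated summit-side namespace (CONVENTIONS §2); for the single-conjunct summit `ABC`
-- the two coincide, so the duplicate `ABC.ABC` is deliberate (the lakefile sets the same option tree-wide).
set_option linter.dupNamespace false

open Finset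
open Literature.NumberTheory.DiophantineGeometry
open Literature.NumberTheory.DiophantineGeometry.AbcShapes

namespace Summit.ABC.ABC.Theorems.MazurKaneLaw.Toolkit

/-! ### The square-root lattice tool (multiplicative forms) -/

/-- THE SQUARE-ROOT LATTICE TOOL, host = the `x`-term (statement; multiplicative form, in the pattern of
`DetTool`): for a set `H` of host coordinates and a coordinate `i ≥ 1` (level `k = i+1 ≥ 2`),
`B_d ≤ #subBox_H X · #subBox_{i} Y · #subBox_{i} Z · Dτ^{d+(i+2)} · (2 + 112 YᵢZᵢ / (c₁ offVal_H X))`: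
freeze everything but `x_H, yᵢ, zᵢ`; `zᵢ ≡ λ yᵢ (mod F)` for `≤ Dτ^{i+2}` root classes, `≤ 2 + 112YᵢZᵢ/F` primitive
lattice points each, `≤ Dτ^d` host tuples per point. Stub `sqrtLatticeToolX` of skeleton v3. -/
def SqrtLatticeToolX : Prop :=
  ∀ {d : ℕ} {c₁ c₂ c₃ : ℕ}, 0 < c₁ → 0 < c₂ → 0 < c₃ →
    ∀ (X Y Z : Fin d → ℕ), (∀ j, 0 < X j) → (∀ j, 0 < Y j) → (∀ j, 0 < Z j) →
    ∀ {T Dτ : ℕ}, c₁ * shapeVal (fun j => 2 * X j) ≤ T → c₂ * shapeVal (fun j => 2 * Y j) ≤ T →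
      c₃ * shapeVal (fun j => 2 * Z j) ≤ T → (∀ m : ℕ, m ≠ 0 → m ≤ T → m.divisors.card ≤ Dτ) →
    ∀ (H : Finset (Fin d)) (i : Fin d), 1 ≤ (i : ℕ) →
      (shapeCount c₁ c₂ c₃ X Y Z : ℝ) ≤
        ((subBox H X).card * (subBox ({i} : Finset (Fin d)) Y).card *
            (subBox ({i} : Finset (Fin d)) Z).card : ℕ) *
          (Dτ : ℝ) ^ (d + ((i : ℕ) + 2)) *
            (2 + 112 * ((Y i : ℝ) * Z i) / ((c₁ * offVal H X : ℕ) : ℝ))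

/-- THE SQUARE-ROOT LATTICE TOOL, host = the `z`-term: for `H` and `i ≥ 1`,
`B_d ≤ #subBox_{i} X · #subBox_{i} Y · #subBox_H Z · Dτ^{d+(i+2)} · (2 + 112 XᵢYᵢ / (c₃ offVal_H Z))`
(`xᵢ ≡ λ yᵢ (mod F)`, `λᵏ ≡ −B/A`). Stub `sqrtLatticeToolZ` of skeleton v3. -/
def SqrtLatticeToolZ : Prop :=
  ∀ {d : ℕ} {c₁ c₂ c₃ : ℕ}, 0 < c₁ → 0 < c₂ → 0 < c₃ →
    ∀ (X Y Z : Fin d → ℕ), (∀ j, 0 < X j) → (∀ j, 0 < Y j) → (∀ j, 0 < Z j) →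
    ∀ {T Dτ : ℕ}, c₁ * shapeVal (fun j => 2 * X j) ≤ T → c₂ * shapeVal (fun j => 2 * Y j) ≤ T →
      c₃ * shapeVal (fun j => 2 * Z j) ≤ T → (∀ m : ℕ, m ≠ 0 → m ≤ T → m.divisors.card ≤ Dτ) →
    ∀ (H : Finset (Fin d)) (i : Fin d), 1 ≤ (i : ℕ) →
      (shapeCount c₁ c₂ c₃ X Y Z : ℝ) ≤
        ((subBox ({i} : Finset (Fin d)) X).card * (subBox ({i} : Finset (Fin d)) Y).card *
            (subBox H Z).card : ℕ) *
          (Dτ : ℝ) ^ (d + ((i : ℕ) + 2)) *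
            (2 + 112 * ((X i : ℝ) * Y i) / ((c₃ * offVal H Z : ℕ) : ℝ))

/-! ### The square-root lattice certificate (exponent form) and the enlarged regions -/

/-- SQUARE-ROOT LATTICE certificate at exponent `θ` (scale `Λ`): some host term `t` with freed coordinate set
`H` and some coordinate `i ≥ 1` such that both branches of `Q(t; H; i+1)` are `≤ θ`:
`L − log_Λ(c_t · shapeVal X_t) + Σ_{j∈H} j·(exponent of t at j) ≤ θ` (main term) and
`L − Σ_{j∈H} (exponent of t at j) − (exponents of the two other terms at i) ≤ θ` (the "+2").
Six host/orientation cases collapse to three by the symmetry of the two freed terms. -/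
def SqrtLatticeCertifies {M : ℕ} (Λ θ : ℝ) (c₁ c₂ c₃ : ℕ) (X Y Z : Fin M → ℕ) : Prop :=
  ∃ (H : Finset (Fin M)) (i : Fin M), 1 ≤ (i : ℕ) ∧
    ((radExp Λ X Y Z - Real.logb Λ ((c₁ * shapeVal X : ℕ) : ℝ) + ∑ j ∈ H, ((j : ℕ) : ℝ) * expo Λ X j ≤ θ ∧
        radExp Λ X Y Z - (∑ j ∈ H, expo Λ X j + expo Λ Y i + expo Λ Z i) ≤ θ) ∨
      (radExp Λ X Y Z - Real.logb Λ ((c₂ * shapeVal Y : ℕ) : ℝ) + ∑ j ∈ H, ((j : ℕ) : ℝ) * expo Λ Y j ≤ θ ∧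
        radExp Λ X Y Z - (∑ j ∈ H, expo Λ Y j + expo Λ X i + expo Λ Z i) ≤ θ) ∨
      (radExp Λ X Y Z - Real.logb Λ ((c₃ * shapeVal Z : ℕ) : ℝ) + ∑ j ∈ H, ((j : ℕ) : ℝ) * expo Λ Z j ≤ θ ∧
        radExp Λ X Y Z - (∑ j ∈ H, expo Λ Z j + expo Λ X i + expo Λ Y i) ≤ θ))

/-- A shape datum is CERTIFIED⁺ at `θ` when the v2 kit (`Certified`: trivial / subset geometry of numbers /
Fourier / determinant) or the square-root lattice tool certifies `D ≤ θ`. -/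
def CertifiedPlus {M : ℕ} (Λ θ : ℝ) (c₁ c₂ c₃ : ℕ) (X Y Z : Fin M → ℕ) : Prop :=
  Certified Λ θ c₁ c₂ c₃ X Y Z ∨ SqrtLatticeCertifies Λ θ c₁ c₂ c₃ X Y Z

/-- The region of data certified⁺ at `θ + τ` (scale `2C₀`); `θ` is a parameter (the law is `θ = s − 1`,
record exponents are other `θ`). The `s`-slot of the region is unused. -/
def TameAt (θ : ℝ) (M : ℕ) (_s τ : ℝ) (C₀ c₁ c₂ c₃ : ℕ) (X Y Z : Fin M → ℕ) : Prop :=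
  CertifiedPlus (scale C₀) (θ + τ) c₁ c₂ c₃ X Y Z

/-- TAME⁺ = certified⁺ at the law `s − 1 + τ` (`= TameAt (s - 1)`, definitionally). -/
def TamePlus (M : ℕ) (s τ : ℝ) (C₀ c₁ c₂ c₃ : ℕ) (X Y Z : Fin M → ℕ) : Prop :=
  CertifiedPlus (scale C₀) (s - 1 + τ) c₁ c₂ c₃ X Y Z

/-- WILD⁺ = not tame⁺: no tool of the enlarged kit reaches the law. The residue of the crux after skeleton v3;
for `s ∈ [7/4, 2)` its known worst boxes are the SYMMETRIC wall `a, b, c = u x² w³` (value `1 − (2−s)/3` by the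
mixed lattice; sub-Minkowski for `Q`). -/
def WildPlus (M : ℕ) (s τ : ℝ) (C₀ c₁ c₂ c₃ : ℕ) (X Y Z : Fin M → ℕ) : Prop :=
  ¬ TamePlus M s τ C₀ c₁ c₂ c₃ X Y Z

/-- Every datum is tame⁺ or wild⁺ (excluded middle; the glue of the v3 composition; registered sub-goal
`tamePlus_or_wildPlus` of crux stmt-ABC-2757, stated verbatim). -/
theorem tamePlus_or_wildPlus : ∀ (M : ℕ) (s τ : ℝ) (C₀ c₁ c₂ c₃ : ℕ) (X Y Z : Fin M → ℕ), Summit.ABC.ABC.Theorems.MazurKaneLaw.Toolkit.TamePlus M s τ C₀ c₁ c₂ c₃ X Y Z ∨ Summit.ABC.ABC.Theorems.MazurKaneLaw.Toolkit.WildPlus M s τ C₀ c₁ c₂ c₃ X Y Z :=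
  fun _ _ _ _ _ _ _ _ _ _ => Classical.em _

/-- Tame data are tame⁺. -/
theorem tamePlus_of_tame {M : ℕ} {s τ : ℝ} {C₀ c₁ c₂ c₃ : ℕ} {X Y Z : Fin M → ℕ}
    (h : Tame M s τ C₀ c₁ c₂ c₃ X Y Z) : TamePlus M s τ C₀ c₁ c₂ c₃ X Y Z :=
  Or.inl h

/-- Wild⁺ data are wild (the v3 residue is contained in the v2 residue). -/
theorem wild_of_wildPlus {M : ℕ} {s τ : ℝ} {C₀ c₁ c₂ c₃ : ℕ} {X Y Z : Fin M → ℕ}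
    (h : WildPlus M s τ C₀ c₁ c₂ c₃ X Y Z) : Wild M s τ C₀ c₁ c₂ c₃ X Y Z :=
  fun ht => h (tamePlus_of_tame ht)

/-! ### The box law at a general exponent -/

/-- THE BOX-LEVEL LAW ON A REGION `R` AT EXPONENT `θ` (data admissible for `(s, ε′)`): for every `η > 0` and
all small `ε′` there is `K ≥ 0` with `B_M ≤ K · C₀^{θ+η}` on admissible data in `R` (tolerance `τ = η/2`).
`BoxLawOn R s` is the case `θ = s − 1` (`boxLawOn_iff_boxLawAt`). -/
def BoxLawAt (R : Region) (s θ : ℝ) : Prop :=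
  ∀ η : ℝ, 0 < η → ∃ ε₀ : ℝ, 0 < ε₀ ∧ ∀ ε' : ℝ, 0 < ε' → ε' ≤ ε₀ → ∃ K : ℝ, 0 ≤ K ∧
    ∀ (C₀ c₁ c₂ c₃ : ℕ) (X Y Z : Fin (numShapes ε') → ℕ),
      Admissible s ε' C₀ c₁ c₂ c₃ X Y Z →
        R (numShapes ε') s (η / 2) C₀ c₁ c₂ c₃ X Y Z →
          (shapeCount c₁ c₂ c₃ X Y Z : ℝ) ≤ K * (C₀ : ℝ) ^ (θ + η)

/-- `BoxLawOn R s ↔ BoxLawAt R s (s - 1)` (definitional). -/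
theorem boxLawOn_iff_boxLawAt (R : Region) (s : ℝ) : BoxLawOn R s ↔ BoxLawAt R s (s - 1) :=
  Iff.rfl

/-! ### The v3 stub statements as named `Prop`s -/

/-- STUB statement `toolkitCertifiedLaw` (provable now; generalises S3 `ToolkitTame`): with the determinant tool
and the two square-root lattice tools, data admissible for `(s, ε′)` and certified⁺ at `θ + η/2` obey
`B_M ≤ K C₀^{θ+η}` — for EVERY real `θ` (the proof of `toolkitTame` never used `θ = s − 1`): the exponent
dictionary (`trivial_linear`, `geometry_disjunction`, `fourier_linear`, `det_linear`, and a new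
`sqrtLattice_linear`) plus the endgame constants. At `θ = s − 1` it is `BoxLawOn TamePlus s`. -/
def ToolkitCertifiedLaw : Prop :=
  DetTool → SqrtLatticeToolX → SqrtLatticeToolZ → ∀ s θ : ℝ, BoxLawAt (TameAt θ) s θ

/-- STUB statement `wallResidualPlus` (OPEN; the line's target after v3): WILD⁺ boxes obey the law for
`s ∈ [5/3, 2)`. Implied by the crux at `s + O(ε′)`; contains the symmetric wall at the law. -/
def WallResidualPlus : Prop :=
  ∀ s : ℝ, 5 / 3 ≤ s → s < 2 → BoxLawOn WildPlus s

/-- STUB statement `deepResidualPlus` (OPEN, hardest; promotion candidate): WILD⁺ boxes obey the law for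
`s ∈ (1, 5/3)` (as `s → 1⁺` it contains "abc hits `≪ N^δ` for every `δ > 0`"). -/
def DeepResidualPlus : Prop :=
  ∀ s : ℝ, 1 < s → s < 5 / 3 → BoxLawOn WildPlus s

end Summit.ABC.ABC.Theorems.MazurKaneLaw.Toolkit

end
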